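import Summits.AtomisticToContinuum.HydrodynamicLimit.Theorems.InformationPercolationEnginePercolationClosesChaosForecastTransferArch
import Summits.AtomisticToContinuum.HydrodynamicLimit.Theorems.InformationPercolationEnginePercolationClosesChaosForecastFiltration
import Summits.AtomisticToContinuum.HydrodynamicLimit.Theorems.InformationPercolationEnginePercolationClosesChaosDockingMeasurable
import Summits.AtomisticToContinuum.HydrodynamicLimit.Theorems.InformationPercolationEnginePercolationClosesChaosCesaroStaticAssembly
import HarnessLib

/-!
# Forecast transfer S6 of the line `equilibrium-forecast-chain-rule` (crux `InformationPercolationEngine.PercolationClosesChaos`,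
stmt-AtomisticToContinuum-15178) — piece H5a: the forecast bookkeeping `ForecastAlgebra` — toolbox, parts (i) and (iv), and the
empty-cell pull-out

Support file (`--supports stmt-AtomisticToContinuum-15178`) of the registered stub `stub_forecastTransfer` (worker W2 of lead c3,
skeleton v5): the fifth hypothesis `H5 = ForecastAlgebra` of the architecture `kineticCellChaosLG_of` (piece A,
`…ForecastTransferArch`) is pure bookkeeping about the means `unitMean c σ N τ μ F = ∫ unitAvg (k q ↦ F k q z) dμ` of unit-indexed
families and their `G_N`-forecasts `gForecast b c σ N Φ F k q = E_{G_N}[F k q | σ(seqHist b c σ N Φ k q)]`. This file is the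
toolbox, the two parts that involve no conditional-expectation algebra, and the one lemma of part (iii) that reads the
filtration:

* laws: `eqLaw_absolutelyContinuous` (`G_N ≪ liouville`), `localGibbsLaw_absolutelyContinuous_liouville`, `isProbabilityMeasure_eqLaw`,
  `ae_mem_good_of_ac` (a law `≪ liouville` lives on the good set of the flow);
* per-unit integrability: `badWeight_le_level` (`badWeight ≤ T`), `abs_badWeight_le_level`, `integrable_badWeight_of_ac`
  (a.e.-measurable for Liouville by the docking's piece M `aemeasurable_badWeight`, transported by `≪`, bounded by `T`),
  `measurable_unitFamily` (a revealed box-supported family is Borel unit by unit, piece F′), `integrable_of_measurable_abs_le`,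
  `integrable_unitIndicator`;
* forecasts: `measurable_gForecast` (`σ(seqHist k q) ≤` Borel), `gForecast_apply_eq_zero_of_forall` (the forecast of a vanishing
  unit is the zero function), `ae_gForecast_nonneg`, `ae_abs_gForecast_le`, `integrable_gForecast` (under any finite `μ ≪ G_N`);
* unit means: `integrable_unitAvg_family` (finite box sums, `unitAvg_eq_sum`), `unitMean_mono_ae`, `unitMean_add_family`,
  `unitMean_const_mul_family`, `unitAvg_boxConst_le` (`unitAvg (δ 𝟙_box) ≤ δ h³ #cellBox h`);
* part (i) `unitMean_badWeight_le_of_le_good` (registered headline): domination `badWeight ≤ X` on the good set passes to the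
  means under every law `≪ liouville` (`integral_mono_of_nonneg`: no measurability of `badWeight` is needed), and its
  specialisation `unitMean_badWeight_le_of_revealed` to revealed `[0, T]`-valued box-supported majorants (Borel unit by unit);
* part (iv) `lintegral_unitAvg_badWeight_eq`: `∫⁻ ofReal (unitAvg badWeight) dμ = ofReal (unitMean μ badWeight)` for finite
  `μ ≪ liouville` (`ofReal_integral_eq_lintegral_ofReal`);
* the EMPTY-CELL PULL-OUT `ae_gForecast_badWeight_eq_zero_of_empty`: `E_{G_N}[badWeight (k,q) | σ(seqHist k q)] = 0` `G_N`-a.e.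
  where cell `q` holds no sphere at `kΔ` — on the good set that event is the `σ(seqHist k q)`-measurable set
  `{∀ i, (obs k · i).1.1 ≠ q}` (`measurableSet_comap_seqHist_noObs`: the last snapshot of the past IS `obs k`) and `badWeight (k, q)`
  vanishes on it (`badWeight_eq_zero_of_forall_ne`: the owner of a contact pair is the start cell of a member), so `condExp_indicator`
  pulls the indicator of its complement out of the forecast.
Parts (ii), (iii) and the assembly `forecastAlgebra_holds` are the companion piece H5b (`…ForecastAlgebra`).
-/

noncomputable section

open MeasureTheory Set Filter Topology
open scoped ENNReal BigOperators Classical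
open Literature.Analysis.FluidPDE Literature.MathematicalPhysics.KineticTheory
open Literature.MathematicalPhysics.KineticTheory.VelocityBlindPlacement

namespace Summit.AtomisticToContinuum.HydrodynamicLimit.Theorems.EquilibriumForecastLine

variable {σ : ℝ} {N : ℕ}

/-! ## Laws -/

/-- The invariant law `G_N = eqLaw` is absolutely continuous with respect to the Liouville measure (it is a `particleLaw`,
Liouville with a density). [folklore] -/
theorem eqLaw_absolutelyContinuous (σ : ℝ) (N : ℕ) (Φ : Flow σ N) :
    eqLaw σ N Φ ≪ liouville G3 (N + 1) (hsDiameter σ N) := by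
  unfold eqLaw localGibbsLaw particleLaw
  exact withDensity_absolutelyContinuous _ _

/-- Every local Gibbs law is absolutely continuous with respect to the Liouville measure. [folklore] -/
theorem localGibbsLaw_absolutelyContinuous_liouville (σ : ℝ) (a₀ : T3 → ℝ) (u₀ : T3 → V3) (θ₀ : T3 → ℝ) (N : ℕ)
    (Φ : Flow σ N) : localGibbsLaw σ a₀ u₀ θ₀ N Φ ≪ liouville G3 (N + 1) (hsDiameter σ N) := by
  unfold localGibbsLaw particleLaw
  exact withDensity_absolutelyContinuous _ _

/-- `G_N` is a probability measure for `σ ≤ 1/2`. [folklore] -/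
theorem isProbabilityMeasure_eqLaw (hσ2 : σ ≤ 1 / 2) (N : ℕ) (Φ : Flow σ N) : IsProbabilityMeasure (eqLaw σ N Φ) :=
  isProbabilityMeasure_localGibbsLaw (a₀ := fun _ => (1 : ℝ)) (θ₀ := fun _ => (1 : ℝ)) (u₀ := fun _ => (0 : V3))
    continuous_const continuous_const continuous_const (fun _ => one_pos) (fun _ => one_pos) hσ2 N Φ

/-- A law absolutely continuous with respect to Liouville lives on the good set of the flow. [folklore] -/
theorem ae_mem_good_of_ac (Φ : Flow σ N) {μ : Measure (Phase N)} (hμ : μ ≪ liouville G3 (N + 1) (hsDiameter σ N)) :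
    ∀ᵐ z ∂μ, z ∈ Φ.good :=
  hμ.ae_le Φ.ae_mem_good

/-! ## Per-unit bounds and integrability -/

/-- `badWeight ≤ T` (`0 ≤ T`). [folklore] -/
theorem badWeight_le_level (Ψ : V3 × V3 × V3 → ℝ) (η : ℝ) {T : ℝ} (hT : 0 ≤ T) (c σ : ℝ) (N : ℕ) (Φ : Flow σ N) (k : ℕ)
    (q : Cell) (z : Phase N) : badWeight Ψ η T c σ N Φ k q z ≤ T := by
  unfold badWeight
  split_ifs
  · rw [mul_one]
    exact min_le_right _ _
  · rw [mul_zero]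
    exact hT

/-- `|badWeight| ≤ T` (`0 ≤ c`, `0 < σ`, `0 ≤ T`). [folklore] -/
theorem abs_badWeight_le_level {c : ℝ} (hc : 0 ≤ c) (hσ : 0 < σ) (Ψ : V3 × V3 × V3 → ℝ) (η : ℝ) {T : ℝ} (hT : 0 ≤ T)
    (Φ : Flow σ N) (k : ℕ) (q : Cell) (z : Phase N) : |badWeight Ψ η T c σ N Φ k q z| ≤ T :=
  abs_le.2 ⟨by linarith [badWeight_nonneg hc hσ Ψ η hT Φ k q z], badWeight_le_level Ψ η hT c σ N Φ k q z⟩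

/-- A quantity in `[0, T]` has absolute value at most `T`. [folklore] -/
theorem abs_le_of_unitBounds {x T : ℝ} (h : 0 ≤ x ∧ x ≤ T) : |x| ≤ T :=
  abs_le.2 ⟨by linarith [h.1, h.2], h.2⟩

/-- A Borel function with `|X| ≤ T` is integrable under a finite law. [folklore] -/
theorem integrable_of_measurable_abs_le (μ : Measure (Phase N)) [IsFiniteMeasure μ] {X : Phase N → ℝ} (hXm : Measurable X)
    {T : ℝ} (hX : ∀ z, |X z| ≤ T) : Integrable X μ :=
  (integrable_const T).mono' hXm.aestronglyMeasurable (ae_of_all _ fun z => by rw [Real.norm_eq_abs]; exact hX z)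

/-- **`badWeight Ψ η T (k, q)` is integrable under every finite law `≪ liouville`** (`0 < σ < 1/2`, `Ψ` continuous, `0 ≤ T`,
`0 < c`): a.e.-measurable by the docking's piece M, bounded by `T`. [folklore] -/
theorem integrable_badWeight_of_ac (Φ : Flow σ N) (μ : Measure (Phase N)) [IsFiniteMeasure μ]
    (hμ : μ ≪ liouville G3 (N + 1) (hsDiameter σ N)) (hσ : 0 < σ) (hσ2 : σ < 2⁻¹) {Ψ : V3 × V3 × V3 → ℝ} (hΨ : Continuous Ψ)
    (η : ℝ) {T c : ℝ} (hT : 0 ≤ T) (hc : 0 < c) (k : ℕ) (q : Cell) :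
    Integrable (badWeight Ψ η T c σ N Φ k q) μ := by
  have hae : AEStronglyMeasurable (badWeight Ψ η T c σ N Φ k q) μ :=
    ((aemeasurable_badWeight Φ hσ hσ2 hΨ η T hc k q).mono_ac hμ).aestronglyMeasurable
  refine (integrable_const T).mono' hae (ae_of_all _ fun z => ?_)
  rw [Real.norm_eq_abs]
  exact abs_badWeight_le_level hc.le hσ Ψ η hT Φ k q z

/-- A revealed, box-supported unit family is Borel unit by unit (piece F′: a function constant on the atoms of `seqHistLE k q` is
`σ(seqHistLE k q)`-measurable and `σ(seqHistLE k q) ≤` Borel; off the box the unit is the constant `0`). [folklore] -/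
theorem measurable_unitFamily (Φ : Flow σ N) (b c : ℝ) {X : ℕ → Cell → Phase N → ℝ}
    (hX0 : ∀ k, ∀ q ∉ cellBox (c * meanFreePath σ N), X k q = fun _ => 0)
    (hXa : ∀ k q, q ∈ cellBox (c * meanFreePath σ N) → ∀ z z',
      seqHistLE b c σ N Φ k q z = seqHistLE b c σ N Φ k q z' → X k q z = X k q z') (k : ℕ) (q : Cell) :
    Measurable (X k q) := by
  by_cases hq : q ∈ cellBox (c * meanFreePath σ N)
  · exact (measurable_comap_top_of_imp (hXa k q hq)).mono (comap_seqHistLE_le Φ b c k q) le_rfl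
  · rw [hX0 k q hq]
    exact measurable_const

/-- The indicator of a measurable unit event is integrable under a finite law. [folklore] -/
theorem integrable_unitIndicator (μ : Measure (Phase N)) [IsFiniteMeasure μ] {P : Phase N → Prop} {_inst : ∀ z, Decidable (P z)}
    (hP : MeasurableSet {z | P z}) : Integrable (fun z => if P z then (1 : ℝ) else 0) μ := by
  refine (integrable_const (1 : ℝ)).mono' (Measurable.ite hP measurable_const measurable_const).aestronglyMeasurable
    (ae_of_all _ fun z => ?_)
  rw [Real.norm_eq_abs]
  split_ifs <;> norm_num

/-! ## Forecasts -/

/-- A `G_N`-forecast is Borel (`condExp` is `σ(seqHist k q)`-strongly measurable and `σ(seqHist k q) ≤` Borel). [folklore] -/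
theorem measurable_gForecast (Φ : Flow σ N) (b c : ℝ) (F : ℕ → Cell → Phase N → ℝ) (k : ℕ) (q : Cell) :
    Measurable (gForecast b c σ N Φ F k q) := by
  show Measurable (MeasureTheory.condExp (MeasurableSpace.comap (seqHist b c σ N Φ k q) ⊤) (eqLaw σ N Φ) (F k q))
  exact (stronglyMeasurable_condExp.mono (comap_seqHist_le Φ b c k q)).measurable

/-- The forecast of an identically vanishing unit is the zero function (`condExp` of `0` is `0`). [folklore] -/
theorem gForecast_apply_eq_zero_of_forall (Φ : Flow σ N) (b c : ℝ) {F : ℕ → Cell → Phase N → ℝ} {k : ℕ} {q : Cell}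
    (h : ∀ z, F k q z = 0) (z : Phase N) : gForecast b c σ N Φ F k q z = 0 := by
  have h0 : F k q = fun _ => 0 := funext h
  show MeasureTheory.condExp (MeasurableSpace.comap (seqHist b c σ N Φ k q) ⊤) (eqLaw σ N Φ) (F k q) z = 0
  rw [h0, condExp_fun_zero]

/-- The forecast of a nonnegative unit is `G_N`-a.e. nonnegative (`condExp_nonneg`). [folklore] -/
theorem ae_gForecast_nonneg (Φ : Flow σ N) (b c : ℝ) {F : ℕ → Cell → Phase N → ℝ} {k : ℕ} {q : Cell}
    (h : ∀ z, 0 ≤ F k q z) : ∀ᵐ z ∂(eqLaw σ N Φ), 0 ≤ gForecast b c σ N Φ F k q z := by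
  have h0 : (0 : Phase N → ℝ) ≤ᵐ[eqLaw σ N Φ] F k q := ae_of_all _ fun z => h z
  have h1 := condExp_nonneg (m := MeasurableSpace.comap (seqHist b c σ N Φ k q) ⊤) h0
  filter_upwards [h1] with z hz
  exact hz

/-- The forecast of a unit with `|F| ≤ T` is `G_N`-a.e. bounded by `T` in absolute value. [folklore] -/
theorem ae_abs_gForecast_le (Φ : Flow σ N) (b c : ℝ) {F : ℕ → Cell → Phase N → ℝ} {T : ℝ} (k : ℕ) (q : Cell)
    (h : ∀ z, |F k q z| ≤ T) : ∀ᵐ z ∂(eqLaw σ N Φ), |gForecast b c σ N Φ F k q z| ≤ T := by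
  have h1 : ∀ᵐ z ∂(eqLaw σ N Φ),
      |MeasureTheory.condExp (MeasurableSpace.comap (seqHist b c σ N Φ k q) ⊤) (eqLaw σ N Φ) (F k q) z| ≤ T :=
    ae_bdd_abs_condExp_of_ae_bdd_abs (ae_of_all _ h)
  filter_upwards [h1] with z hz
  exact hz

/-- **A forecast of a unit with `|F| ≤ T` is integrable under every finite law `μ ≪ G_N`** (Borel, and `μ`-a.e. bounded by `T`
because `G_N`-a.e. bounded). [folklore] -/
theorem integrable_gForecast (Φ : Flow σ N) (b c : ℝ) {μ : Measure (Phase N)} [IsFiniteMeasure μ] (hμ : μ ≪ eqLaw σ N Φ)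
    {F : ℕ → Cell → Phase N → ℝ} {T : ℝ} (k : ℕ) (q : Cell) (h : ∀ z, |F k q z| ≤ T) :
    Integrable (gForecast b c σ N Φ F k q) μ := by
  have hbd : ∀ᵐ z ∂μ, |gForecast b c σ N Φ F k q z| ≤ T := hμ.ae_le (ae_abs_gForecast_le Φ b c k q h)
  exact (integrable_const T).mono' (measurable_gForecast Φ b c F k q).aestronglyMeasurable
    (hbd.mono fun z hz => by rw [Real.norm_eq_abs]; exact hz)

/-! ## Unit means -/

/-- **The unit average of a box-supported family of integrable units is integrable** (a finite box sum, `unitAvg_eq_sum`). [folklore] -/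
theorem integrable_unitAvg_family {μ : Measure (Phase N)} {c : ℝ} (τ : ℝ) {F : ℕ → Cell → Phase N → ℝ}
    (hbox : ∀ (z : Phase N) (k : ℕ), ∀ q ∉ cellBox (c * meanFreePath σ N), F k q z = 0)
    (hint : ∀ k q, Integrable (F k q) μ) :
    Integrable (fun z => unitAvg c σ N τ fun k q => F k q z) μ := by
  have hfun : (fun z => unitAvg c σ N τ fun k q => F k q z) = fun z => ((numSteps c σ N τ : ℝ))⁻¹ * (c * meanFreePath σ N) ^ 3 *
      ∑ k ∈ Finset.range (numSteps c σ N τ), ∑ q ∈ cellBox (c * meanFreePath σ N), F k q z :=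
    funext fun z => unitAvg_eq_sum c σ N τ _ (hbox z)
  rw [hfun]
  exact (integrable_finsetSum _ fun k _ => integrable_finsetSum _ fun q _ => hint k q).const_mul _

/-- Monotonicity of unit means along an a.e. unit-wise domination of box-supported families. [folklore] -/
theorem unitMean_mono_ae {μ : Measure (Phase N)} {c : ℝ} (τ : ℝ) {F G : ℕ → Cell → Phase N → ℝ}
    (h0 : 0 ≤ c * meanFreePath σ N)
    (hF : ∀ (z : Phase N) (k : ℕ), ∀ q ∉ cellBox (c * meanFreePath σ N), F k q z = 0)
    (hG : ∀ (z : Phase N) (k : ℕ), ∀ q ∉ cellBox (c * meanFreePath σ N), G k q z = 0)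
    (hFi : Integrable (fun z => unitAvg c σ N τ fun k q => F k q z) μ)
    (hGi : Integrable (fun z => unitAvg c σ N τ fun k q => G k q z) μ)
    (hFG : ∀ᵐ z ∂μ, ∀ k q, F k q z ≤ G k q z) :
    unitMean c σ N τ μ F ≤ unitMean c σ N τ μ G :=
  integral_mono_ae hFi hGi (hFG.mono fun z hz => unitAvg_mono h0 (hF z) (hG z) hz)

/-- Additivity of unit means on box-supported families with integrable unit averages. [folklore] -/
theorem unitMean_add_family {μ : Measure (Phase N)} {c : ℝ} (τ : ℝ) {F G : ℕ → Cell → Phase N → ℝ}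
    (hF : ∀ (z : Phase N) (k : ℕ), ∀ q ∉ cellBox (c * meanFreePath σ N), F k q z = 0)
    (hG : ∀ (z : Phase N) (k : ℕ), ∀ q ∉ cellBox (c * meanFreePath σ N), G k q z = 0)
    (hFi : Integrable (fun z => unitAvg c σ N τ fun k q => F k q z) μ)
    (hGi : Integrable (fun z => unitAvg c σ N τ fun k q => G k q z) μ) :
    unitMean c σ N τ μ (fun k q z => F k q z + G k q z) = unitMean c σ N τ μ F + unitMean c σ N τ μ G := by
  unfold unitMean
  rw [← integral_add hFi hGi]
  refine integral_congr_ae (ae_of_all _ fun z => ?_)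
  exact unitAvg_add' τ (hF z) (hG z)

/-- Homogeneity of unit means. [folklore] -/
theorem unitMean_const_mul_family {μ : Measure (Phase N)} (c : ℝ) (τ a : ℝ) (F : ℕ → Cell → Phase N → ℝ) :
    unitMean c σ N τ μ (fun k q z => a * F k q z) = a * unitMean c σ N τ μ F := by
  unfold unitMean
  rw [← integral_const_mul]
  refine integral_congr_ae (ae_of_all _ fun z => ?_)
  exact unitAvg_const_mul' c σ N τ a _

/-- The unit average of the constant `δ ≥ 0` on the box is at most `δ · h³ · #cellBox h` (equality when `K_N > 0`). [folklore] -/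
theorem unitAvg_boxConst_le {c : ℝ} (τ : ℝ) {δ : ℝ} (hδ : 0 ≤ δ) (hh : 0 ≤ c * meanFreePath σ N) :
    unitAvg c σ N τ (fun _ q => if q ∈ cellBox (c * meanFreePath σ N) then δ else 0) ≤
      δ * ((c * meanFreePath σ N) ^ 3 * (cellBox (c * meanFreePath σ N)).card) := by
  rw [unitAvg_eq_sum c σ N τ _ fun k q hq => if_neg hq]
  have hin : ∀ k ∈ Finset.range (numSteps c σ N τ), ∑ q ∈ cellBox (c * meanFreePath σ N),
      (if q ∈ cellBox (c * meanFreePath σ N) then δ else 0) = ((cellBox (c * meanFreePath σ N)).card : ℝ) * δ := by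
    intro k _
    rw [Finset.sum_congr rfl fun q hq => if_pos hq, Finset.sum_const, nsmul_eq_mul]
  rw [Finset.sum_congr rfl hin, Finset.sum_const, Finset.card_range, nsmul_eq_mul]
  rcases Nat.eq_zero_or_pos (numSteps c σ N τ) with hK | hK
  · rw [hK, Nat.cast_zero, zero_mul, mul_zero]
    positivity
  · have hKr : (numSteps c σ N τ : ℝ) ≠ 0 := by exact_mod_cast hK.ne'
    apply le_of_eq
    field_simp

/-! ## Part (i): domination on the good set passes to the means -/

/-- **Registered helper, part (i) of `ForecastAlgebra`: domination on the good set passes to the means.** For every finite law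
`μ ≪ liouville` on the phase space, `0 < σ`, `0 ≤ T`, `0 < c`, and every box-supported unit family `X` with `badWeight Ψ η T ≤ X`
unit by unit on the good set of the flow and integrable unit average: `unitMean μ (badWeight Ψ η T) ≤ unitMean μ X`
(`μ(goodᶜ) = 0`; `integral_mono_of_nonneg`, the unit average of `badWeight` being nonnegative). [folklore] -/
theorem unitMean_badWeight_le_of_le_good : ∀ {σ : ℝ} {N : ℕ} (Φ : Flow σ N) (μ : Measure (Phase N)), μ ≪ liouville G3 (N + 1) (hsDiameter σ N) → 0 < σ → ∀ (Ψ : V3 × V3 × V3 → ℝ) (η : ℝ) {T c : ℝ} (τ : ℝ), 0 ≤ T → 0 < c → ∀ (X : ℕ → Cell → Phase N → ℝ), (∀ (z : Phase N) (k : ℕ), ∀ q ∉ cellBox (c * meanFreePath σ N), X k q z = 0) → Integrable (fun z => unitAvg c σ N τ fun k q => X k q z) μ → (∀ k q, ∀ z ∈ Φ.good, badWeight Ψ η T c σ N Φ k q z ≤ X k q z) → unitMean c σ N τ μ (badWeight Ψ η T c σ N Φ) ≤ unitMean c σ N τ μ X := by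
  intro σ N Φ μ hμ hσ Ψ η T c τ hT hc X hXbox hXi hdom
  have hh : 0 < c * meanFreePath σ N := mul_pos hc (meanFreePath_pos hσ N)
  have hBbox : ∀ (z : Phase N) (k : ℕ), ∀ q ∉ cellBox (c * meanFreePath σ N), badWeight Ψ η T c σ N Φ k q z = 0 :=
    fun z k q hq => badWeight_eq_zero_of_not_mem hh Ψ η hT Φ k hq z
  have h0 : ∀ z, 0 ≤ unitAvg c σ N τ fun k q => badWeight Ψ η T c σ N Φ k q z := fun z =>
    unitAvg_nonneg hh.le (hBbox z) fun k q => badWeight_nonneg hc.le hσ Ψ η hT Φ k q z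
  have hle : ∀ᵐ z ∂μ, (unitAvg c σ N τ fun k q => badWeight Ψ η T c σ N Φ k q z) ≤ unitAvg c σ N τ fun k q => X k q z := by
    filter_upwards [ae_mem_good_of_ac Φ hμ] with z hz
    exact unitAvg_mono hh.le (hBbox z) (hXbox z) fun k q => hdom k q z hz
  exact integral_mono_of_nonneg (ae_of_all _ h0) hXi hle

/-- Part (i) for a REVEALED `[0, T]`-valued box-supported majorant `X` (the form `ForecastAlgebra` (i) consumes: `X` is Borel unit
by unit, hence its unit average is integrable). [folklore] -/
theorem unitMean_badWeight_le_of_revealed (Φ : Flow σ N) (μ : Measure (Phase N)) [IsFiniteMeasure μ]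
    (hμ : μ ≪ liouville G3 (N + 1) (hsDiameter σ N)) (hσ : 0 < σ) (Ψ : V3 × V3 × V3 → ℝ) (η : ℝ) {T c : ℝ} (b τ : ℝ)
    (hT : 0 ≤ T) (hc : 0 < c) {X : ℕ → Cell → Phase N → ℝ} (hXb : ∀ k q z, 0 ≤ X k q z ∧ X k q z ≤ T)
    (hX0 : ∀ k, ∀ q ∉ cellBox (c * meanFreePath σ N), X k q = fun _ => 0)
    (hXa : ∀ k q, q ∈ cellBox (c * meanFreePath σ N) → ∀ z z',
      seqHistLE b c σ N Φ k q z = seqHistLE b c σ N Φ k q z' → X k q z = X k q z')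
    (hdom : ∀ k q, ∀ z ∈ Φ.good, badWeight Ψ η T c σ N Φ k q z ≤ X k q z) :
    unitMean c σ N τ μ (badWeight Ψ η T c σ N Φ) ≤ unitMean c σ N τ μ X := by
  have hXbox : ∀ (z : Phase N) (k : ℕ), ∀ q ∉ cellBox (c * meanFreePath σ N), X k q z = 0 := fun z k q hq => by
    rw [hX0 k q hq]
  have hXi : Integrable (fun z => unitAvg c σ N τ fun k q => X k q z) μ :=
    integrable_unitAvg_family τ hXbox fun k q =>
      integrable_of_measurable_abs_le μ (measurable_unitFamily Φ b c hX0 hXa k q) fun z => abs_le_of_unitBounds (hXb k q z)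
  exact unitMean_badWeight_le_of_le_good Φ μ hμ hσ Ψ η τ hT hc X hXbox hXi hdom

/-! ## Part (iv): the currency -/

/-- **Part (iv) of `ForecastAlgebra`: `∫⁻ ofReal (unitAvg badWeight) dμ = ofReal (unitMean μ badWeight)`** for every finite law
`μ ≪ liouville` (`0 < σ < 1/2`, `Ψ` continuous, `0 ≤ T`, `0 < c`): the unit average of `badWeight` is nonnegative and integrable
(`ofReal_integral_eq_lintegral_ofReal`). [folklore] -/
theorem lintegral_unitAvg_badWeight_eq (Φ : Flow σ N) (μ : Measure (Phase N)) [IsFiniteMeasure μ]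
    (hμ : μ ≪ liouville G3 (N + 1) (hsDiameter σ N)) (hσ : 0 < σ) (hσ2 : σ < 2⁻¹) {Ψ : V3 × V3 × V3 → ℝ} (hΨ : Continuous Ψ)
    (η : ℝ) {T c : ℝ} (τ : ℝ) (hT : 0 ≤ T) (hc : 0 < c) :
    ∫⁻ z, ENNReal.ofReal (unitAvg c σ N τ fun k q => badWeight Ψ η T c σ N Φ k q z) ∂μ =
      ENNReal.ofReal (unitMean c σ N τ μ (badWeight Ψ η T c σ N Φ)) := by
  have hh : 0 < c * meanFreePath σ N := mul_pos hc (meanFreePath_pos hσ N)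
  have hBbox : ∀ (z : Phase N) (k : ℕ), ∀ q ∉ cellBox (c * meanFreePath σ N), badWeight Ψ η T c σ N Φ k q z = 0 :=
    fun z k q hq => badWeight_eq_zero_of_not_mem hh Ψ η hT Φ k hq z
  have h0 : ∀ z, 0 ≤ unitAvg c σ N τ fun k q => badWeight Ψ η T c σ N Φ k q z := fun z =>
    unitAvg_nonneg hh.le (hBbox z) fun k q => badWeight_nonneg hc.le hσ Ψ η hT Φ k q z
  have hint : Integrable (fun z => unitAvg c σ N τ fun k q => badWeight Ψ η T c σ N Φ k q z) μ :=
    integrable_unitAvg_family τ hBbox fun k q => integrable_badWeight_of_ac Φ μ hμ hσ hσ2 hΨ η hT hc k q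
  unfold unitMean
  exact (ofReal_integral_eq_lintegral_ofReal hint (ae_of_all _ h0)).symm

/-! ## The empty-cell pull-out -/

/-- On the good set the cell read off an observation is the start cell. [folklore] -/
theorem obs_cell_eq_startCell_of_good (Φ : Flow σ N) (b c : ℝ) {z : Phase N} (hz : z ∈ Φ.good) (k : ℕ) (i : Fin (N + 1)) :
    (obs b c σ N Φ k z i).1.1 = startCell c σ N Φ k z i := by
  unfold obs
  rw [if_pos hz]
  rfl

/-- A unit whose cell holds no sphere at the step start owns no collision (the owner of a contact pair is the start cell of one
of its members, `cellMin_mem_pair`). [folklore] -/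
theorem ownedCount_eq_zero_of_forall_ne (Φ : Flow σ N) (c : ℝ) (k : ℕ) {q : Cell} {z : Phase N}
    (hne : ∀ i, startCell c σ N Φ k z i ≠ q) : ownedCount c σ N Φ k q z = 0 := by
  unfold ownedCount
  have hfun : (fun (_ : ℝ) (_ : Phase N) (i j : Fin (N + 1)) =>
      if cellMin (startCell c σ N Φ k z i) (startCell c σ N Φ k z j) = q then (1 : ℝ) else 0) =
      fun _ _ _ _ => (0 : ℝ) := by
    funext s w i j
    rw [if_neg]
    intro hi
    rcases cellMin_mem_pair (startCell c σ N Φ k z i) (startCell c σ N Φ k z j) with hm | hm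
    · rw [hm] at hi
      exact hne i hi
    · rw [hm] at hi
      exact hne j hi
  rw [hfun, collisionPairSum_zero_fun, mul_zero]

/-- Hence its increment vanishes (`0 ≤ T`). [folklore] -/
theorem badWeight_eq_zero_of_forall_ne (Φ : Flow σ N) (Ψ : V3 × V3 × V3 → ℝ) (η : ℝ) {T : ℝ} (hT : 0 ≤ T) (c : ℝ) (k : ℕ)
    {q : Cell} {z : Phase N} (hne : ∀ i, startCell c σ N Φ k z i ≠ q) : badWeight Ψ η T c σ N Φ k q z = 0 := by
  unfold badWeight
  rw [ownedCount_eq_zero_of_forall_ne Φ c k hne, min_eq_left hT, zero_mul]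

/-- **The event "no sphere is observed in cell `q` at time `kΔ`" is `σ(seqHist k q)`-measurable**: it is the preimage under
`seqHist b c σ N Φ k q` of a set of histories (the last snapshot of the past `hist k` is `obs k`). [folklore] -/
theorem measurableSet_comap_seqHist_noObs (Φ : Flow σ N) (b c : ℝ) (k : ℕ) (q : Cell) :
    MeasurableSet[MeasurableSpace.comap (seqHist b c σ N Φ k q) ⊤] {z : Phase N | ∀ i, (obs b c σ N Φ k z i).1.1 ≠ q} :=
  ⟨{y | ∀ i, (y.1 (Fin.last k) i).1.1 ≠ q}, MeasurableSpace.measurableSet_top, Set.ext fun _ => Iff.rfl⟩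

/-- **The pull-out: the `G_N`-forecast of `badWeight (k, q)` vanishes `G_N`-a.e. where cell `q` is EMPTY at `kΔ`.** On the good
set, "empty" is the `σ(seqHist k q)`-measurable event `A = {∀ i, (obs k · i).1.1 ≠ q}` and `badWeight (k, q) = 0` on it, so
`badWeight = 𝟙_{Aᶜ} · badWeight` `G_N`-a.e. and `E[badWeight | σ(seqHist k q)] = 𝟙_{Aᶜ} · E[badWeight | σ(seqHist k q)]` a.e.
(`condExp_congr_ae`, `condExp_indicator`). [folklore] -/
theorem ae_gForecast_badWeight_eq_zero_of_empty (Φ : Flow σ N) (hσ : 0 < σ) (hσ2 : σ < 2⁻¹) {Ψ : V3 × V3 × V3 → ℝ}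
    (hΨ : Continuous Ψ) (η : ℝ) {T c : ℝ} (b : ℝ) (hT : 0 ≤ T) (hc : 0 < c) (k : ℕ) (q : Cell) :
    ∀ᵐ z ∂(eqLaw σ N Φ), ¬ (pop c σ N (Φ.flow ((k : ℝ) * stepLen c σ N) z) q).Nonempty →
      gForecast b c σ N Φ (badWeight Ψ η T c σ N Φ) k q z = 0 := by
  set G := eqLaw σ N Φ with hG
  set m := MeasurableSpace.comap (seqHist b c σ N Φ k q) ⊤ with hm
  set f : Phase N → ℝ := badWeight Ψ η T c σ N Φ k q with hf
  set A : Set (Phase N) := {z | ∀ i, (obs b c σ N Φ k z i).1.1 ≠ q} with hA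
  haveI : IsProbabilityMeasure G := isProbabilityMeasure_eqLaw (hσ2.le.trans (by norm_num)) N Φ
  have hGac : G ≪ liouville G3 (N + 1) (hsDiameter σ N) := eqLaw_absolutelyContinuous σ N Φ
  have hfi : Integrable f G := integrable_badWeight_of_ac Φ G hGac hσ hσ2 hΨ η hT hc k q
  have hAm : MeasurableSet[m] A := measurableSet_comap_seqHist_noObs Φ b c k q
  -- the increment vanishes on `A ∩ good`
  have hfA : ∀ z ∈ Φ.good, z ∈ A → f z = 0 := by
    intro z hz hzA
    refine badWeight_eq_zero_of_forall_ne Φ Ψ η hT c k fun i => ?_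
    rw [← obs_cell_eq_startCell_of_good Φ b c hz k i]
    exact hzA i
  -- hence `f = 𝟙_{Aᶜ} f` a.e.
  have hind : f =ᵐ[G] Aᶜ.indicator f := by
    filter_upwards [ae_mem_good_of_ac Φ hGac] with z hz
    by_cases hzA : z ∈ A
    · have hzc : z ∉ Aᶜ := fun h => h hzA
      rw [Set.indicator_of_notMem hzc, hfA z hz hzA]
    · rw [Set.indicator_of_mem (Set.mem_compl hzA)]
  have h1 : MeasureTheory.condExp m G f =ᵐ[G] MeasureTheory.condExp m G (Aᶜ.indicator f) := condExp_congr_ae hind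
  have h2 : MeasureTheory.condExp m G (Aᶜ.indicator f) =ᵐ[G] Aᶜ.indicator (MeasureTheory.condExp m G f) :=
    condExp_indicator hfi hAm.compl
  filter_upwards [h1, h2, ae_mem_good_of_ac Φ hGac] with z hz1 hz2 hz hne
  have hzA : z ∈ A := by
    intro i hi
    refine hne ⟨i, Finset.mem_filter.2 ⟨Finset.mem_univ i, ?_⟩⟩
    rw [obs_cell_eq_startCell_of_good Φ b c hz k i] at hi
    exact hi
  have hzc : z ∉ Aᶜ := fun h => h hzA
  show MeasureTheory.condExp m G f z = 0
  rw [hz1, hz2, Set.indicator_of_notMem hzc]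

end Summit.AtomisticToContinuum.HydrodynamicLimit.Theorems.EquilibriumForecastLine

end
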